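import Mathlib.Data.Fintype.Prod
import Mathlib.Order.Nat
import Literature.Combinatorics.SimpleGraph.RemovableArc
import Literature.Combinatorics.SimpleGraph.ClosedWalkCycles
import HarnessLib

/-!
# Minimally strongly connected digraphs without digons have at most `2m - 3` arcs

Topic `Combinatorics/SimpleGraph`; theorems only. A digraph lemma for the finish of the hard
direction of Little's theorem (`Little1975_isPfaffianBipartite_iff_not_isMatchingMinor`,
`LittleTheorem.lean`), in the vocabulary of `MatchingDigraph.lean` (`IsArc K`, `IsStrong K` for
`K ⊆ Fin m × Fin m`):

* `isStrong_erase_of_strongSub` — if `D(K, M)` is strongly connected and contains a strongly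
  connected sub-digraph `(W, E)`, then every arc `g ∉ E` with both ends in `W` is removable
  (`D − g` is strongly connected): paths into and out of `W` can be cut at their first / last
  vertex in `W`, and inside `W` one moves along `E`;
* `card_arcs_le_of_minimallyStrong` — **a strongly connected digraph on `m ≥ 3` vertices without
  directed 2-circuits in which NO arc is removable has at most `2m - 3` arcs.** Proof: grow a
  strongly connected sub-digraph from a directed circuit (of length `≥ 3`) by ears; by the previous
  lemma every arc inside the current vertex set already belongs to it, so each ear through `k ≥ 1`
  new vertices adds exactly `k + 1` arcs, keeping `|E| ≤ 2|W| - 3` (the classical bound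
  `|A| ≤ 2(m - 1)` for minimally strong digraphs, sharpened by one when some circuit is not a
  digon).

## References

* P. D. Seymour, C. Thomassen, *Characterization of even directed graphs*, J. Combin. Theory
  Ser. B 42 (1987) 36–45, §2 (ear decompositions), §4. [SeymourThomassen1987]
-/

namespace Literature.Combinatorics.SimpleGraph

open Finset

/-! ### A last position inside a set -/

/-- A list starting inside `W` has a last position inside `W`. [folklore] -/
theorem exists_last_mem {α : Type*} (W : Set α) [DecidablePred (· ∈ W)] (l : List α) (hne : l ≠ [])
    (hhead : l.head hne ∈ W) :
    ∃ (k : ℕ) (hk : k < l.length), l[k] ∈ W ∧ ∀ (j : ℕ) (hj : j < l.length), k < j → l[j] ∉ W := by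
  classical
  let P : ℕ → Prop := fun j => ∃ h : j < l.length, l[j] ∈ W
  have hP0 : P 0 := ⟨List.length_pos_iff.2 hne, by rw [← List.head_eq_getElem hne]; exact hhead⟩
  obtain ⟨hk, hkW⟩ : P (Nat.findGreatest P (l.length - 1)) :=
    Nat.findGreatest_spec (P := P) (Nat.zero_le _) hP0
  refine ⟨Nat.findGreatest P (l.length - 1), hk, hkW, fun j hj hkj hjW => ?_⟩
  exact Nat.findGreatest_is_greatest (P := P) hkj (by omega) ⟨hj, hjW⟩

variable {m : ℕ} {K : Finset (Fin m × Fin m)}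

/-! ### Arcs inside a strongly connected sub-digraph are removable -/

/-- **An arc spanned by a strongly connected sub-digraph not containing it is removable.** If
`D(K, M)` is strongly connected, `(W, E)` is a sub-digraph of it in which every two vertices of
`W` are joined along arcs of `E`, and `g ∉ E` is an arc with both ends in `W`, then `D − g` is
strongly connected. [folklore] -/
theorem isStrong_erase_of_strongSub (hs : IsStrong K) {W : Finset (Fin m)}
    {E : Finset (Fin m × Fin m)} (hEK : ∀ e ∈ E, IsArc K e.1 e.2)
    (hstrongE : ∀ x ∈ W, ∀ y ∈ W, Relation.ReflTransGen (fun a b => (a, b) ∈ E) x y)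
    {g : Fin m × Fin m} (hgE : g ∉ E) (hg1 : g.1 ∈ W) (hg2 : g.2 ∈ W) :
    IsStrong (K.erase g) := by
  classical
  intro a b
  -- from `a` to a first vertex of `W`, avoiding `g`
  obtain ⟨l, hc, -, hlast⟩ := hs.exists_path a g.1
  obtain ⟨k, hk, hkW, hfirst⟩ := exists_first_mem (W : Set (Fin m)) (a :: l) (List.cons_ne_nil _ _)
    (by rw [hlast]; exact hg1)
  have hpre : ((a :: l).take (k + 1)).IsChain (IsArc (K.erase g)) := by
    refine isChain_isArc_erase (hc.take (k + 1)) fun i hi heq => ?_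
    simp only [List.length_take] at hi
    simp only [List.getElem_take] at heq
    have h1 : (a :: l)[i] = g.1 := (Prod.ext_iff.1 heq).1
    exact hfirst i (by omega) (by rw [h1]; exact hg1)
  have hpre_ne : (a :: l).take (k + 1) ≠ [] := by simp
  have h1 : Relation.ReflTransGen (IsArc (K.erase g)) a ((a :: l)[k]) := by
    have h := reflTransGen_getElem_getLast hpre hpre_ne (m := 0) (by simp)
    rw [List.getLast_eq_getElem] at h
    simp only [List.getElem_take, List.length_take] at h
    have hmin : min (k + 1) (a :: l).length - 1 = k := by omega
    simp only [hmin] at h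
    exact h
  -- from a last vertex of `W` to `b`, avoiding `g`
  obtain ⟨l', hc', -, hlast'⟩ := hs.exists_path g.2 b
  obtain ⟨k', hk', hk'W, hlastW⟩ := exists_last_mem (W : Set (Fin m)) (g.2 :: l') (List.cons_ne_nil _ _)
    (by exact hg2)
  have hsuf : ((g.2 :: l').drop k').IsChain (IsArc (K.erase g)) := by
    refine isChain_isArc_erase (hc'.drop k') fun i hi heq => ?_
    simp only [List.length_drop] at hi
    simp only [List.getElem_drop] at heq
    have ht : (g.2 :: l')[k' + i] = g.1 := (Prod.ext_iff.1 heq).1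
    have hh : (g.2 :: l')[k' + (i + 1)] = g.2 := (Prod.ext_iff.1 heq).2
    -- the tail `g.1 ∈ W` sits at position `k' + i ≥ k'`, so `i = 0`; then the head `g.2 ∈ W`
    -- sits at position `k' + 1 > k'`
    by_cases hi0 : i = 0
    · subst hi0
      exact hlastW (k' + 1) (by omega) (by omega) (by rw [hh]; exact hg2)
    · exact hlastW (k' + i) (by omega) (by omega) (by rw [ht]; exact hg1)
  have hsuf_ne : (g.2 :: l').drop k' ≠ [] := by
    rw [ne_eq, List.drop_eq_nil_iff, not_le]; exact hk'
  have h3 : Relation.ReflTransGen (IsArc (K.erase g)) ((g.2 :: l')[k']) b := by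
    have h := List.relationReflTransGen_of_exists_isChain ((g.2 :: l').drop k') hsuf hsuf_ne
    rw [List.head_drop, List.getLast_drop, hlast'] at h
    exact h
  -- inside `W`, along `E`
  have h2 : Relation.ReflTransGen (IsArc (K.erase g)) ((a :: l)[k]) ((g.2 :: l')[k']) := by
    refine reflTransGen_of_imp (fun c d hcd => ?_) (hstrongE _ hkW _ hk'W)
    exact isArc_erase_iff.2 ⟨hEK _ hcd, fun h => hgE (h ▸ hcd)⟩
  exact h1.trans (h2.trans h3)

/-! ### The arc bound -/

/-- **A minimally strongly connected digraph without directed 2-circuits on `m ≥ 3` vertices has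
at most `2m - 3` arcs.** [folklore] -/
theorem card_arcs_le_of_minimallyStrong (hs : IsStrong K)
    (hmin : ∀ a b, IsArc K a b → ¬ IsStrong (K.erase (a, b)))
    (hnodigon : ∀ a b, IsArc K a b → ¬ IsArc K b a) (hm : 3 ≤ m) :
    (Finset.univ.filter fun e : Fin m × Fin m => IsArc K e.1 e.2).card + 3 ≤ 2 * m := by
  classical
  set A : Finset (Fin m × Fin m) := Finset.univ.filter fun e => IsArc K e.1 e.2 with hAdef
  have hA : ∀ e : Fin m × Fin m, e ∈ A ↔ IsArc K e.1 e.2 := fun e => by simp [hAdef]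
  -- every arc inside a strongly connected sub-digraph belongs to it
  have hinside : ∀ (W : Finset (Fin m)) (E : Finset (Fin m × Fin m)), E ⊆ A →
      (∀ x ∈ W, ∀ y ∈ W, Relation.ReflTransGen (fun a b => (a, b) ∈ E) x y) →
      ∀ e ∈ A, e.1 ∈ W → e.2 ∈ W → e ∈ E := by
    intro W E hEA hstrongE e heA he1 he2
    by_contra heE
    exact hmin e.1 e.2 ((hA e).1 heA) (isStrong_erase_of_strongSub hs
      (fun f hf => (hA f).1 (hEA hf)) hstrongE heE he1 he2)
  -- growing a strongly connected sub-digraph with `|E| + 3 ≤ 2 |W|`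
  suffices main : ∀ (μ : ℕ) (W : Finset (Fin m)) (E : Finset (Fin m × Fin m)),
      m - W.card = μ → E ⊆ A → (∀ e ∈ E, e.1 ∈ W ∧ e.2 ∈ W) → W.Nonempty →
      (∀ x ∈ W, ∀ y ∈ W, Relation.ReflTransGen (fun a b => (a, b) ∈ E) x y) →
      E.card + 3 ≤ 2 * W.card → A.card + 3 ≤ 2 * m by
    -- start from a directed circuit of length `≥ 3`
    obtain ⟨v₀, v₁, hv₁⟩ : ∃ v₀ v₁ : Fin m, v₁ ≠ v₀ :=
      ⟨⟨0, by omega⟩, ⟨1, by omega⟩, fun h => by have := congrArg Fin.val h; simp at this⟩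
    -- an arc `a → b`: the first arc of a path from `v₀` to `v₁`
    obtain ⟨l₀, hc₀, -, hlast₀⟩ := hs.exists_path v₀ v₁
    obtain ⟨b, l₀', rfl⟩ : ∃ b l₀', l₀ = b :: l₀' := by
      cases l₀ with
      | nil => exact absurd hlast₀ hv₁.symm
      | cons b l₀' => exact ⟨b, l₀', rfl⟩
    have hab : IsArc K v₀ b := (List.isChain_cons_cons.1 hc₀).1
    -- a path back from `b` to `a := v₀`; the circuit `a → b ⇝ a`
    obtain ⟨l, hc, hnd, hlast⟩ := hs.exists_path b v₀
    set C := v₀ :: b :: l with hC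
    have hCchain : C.IsChain (IsArc K) := List.IsChain.cons_cons hab hc
    -- `l ≠ []` and `l ≠ [v₀]` would give... : the circuit has at least three vertices (no digon)
    have hl2 : 2 ≤ (b :: l).length := by
      cases l with
      | nil => exact absurd hlast hab.1.symm
      | cons c l' =>
        simp
    have hW0card : 3 ≤ (b :: l).toFinset.card := by
      rw [List.toFinset_card_of_nodup hnd]
      -- length `2` would mean `l = [v₀]`: the digon `v₀ ⇄ b`
      by_contra hlt
      have hlen : (b :: l).length = 2 := by omega
      obtain ⟨c, rfl⟩ : ∃ c, l = [c] := by
        cases l with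
        | nil => simp at hlen
        | cons c l' =>
          cases l' with
          | nil => exact ⟨c, rfl⟩
          | cons _ _ => simp at hlen
      have hcv : c = v₀ := by simpa using hlast
      subst hcv
      exact hnodigon _ _ hab (List.isChain_cons_cons.1 hc).1
    refine main _ (b :: l).toFinset (C.zip C.tail).toFinset rfl ?_ ?_ ?_ ?_ ?_
    · intro e he
      rw [hA]
      exact rel_of_mem_zip_tail hCchain (List.mem_toFinset.1 he)
    · intro e he
      have h12 := List.of_mem_zip (List.mem_toFinset.1 he)
      refine ⟨?_, List.mem_toFinset.2 h12.2⟩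
      -- `e.1 ∈ C = v₀ :: b :: l`, and `v₀` is the last vertex of `b :: l`
      rcases List.mem_cons.1 h12.1 with h | h
      · rw [List.mem_toFinset, h, ← hlast]; exact List.getLast_mem _
      · exact List.mem_toFinset.2 h
    · exact ⟨b, List.mem_toFinset.2 List.mem_cons_self⟩
    · -- along the circuit
      have hCchain' : C.IsChain (fun a b => (a, b) ∈ (C.zip C.tail).toFinset) := by
        rw [List.isChain_iff_getElem]
        intro j hj
        rw [List.mem_toFinset, List.mem_iff_getElem]
        refine ⟨j, by simp; omega, ?_⟩
        rw [List.getElem_zip]; simp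
      have hCne : C ≠ [] := List.cons_ne_nil _ _
      have hClast : C.getLast hCne = v₀ := by
        show (v₀ :: b :: l).getLast (List.cons_ne_nil _ _) = v₀
        rw [List.getLast_cons_cons, hlast]
      have hto : ∀ q ∈ C, Relation.ReflTransGen (fun a b => (a, b) ∈ (C.zip C.tail).toFinset) q v₀ := by
        intro q hq
        obtain ⟨j, hj, rfl⟩ := List.getElem_of_mem hq
        rw [← hClast]
        exact reflTransGen_getElem_getLast hCchain' hCne hj
      have hfrom : ∀ q ∈ C, Relation.ReflTransGen (fun a b => (a, b) ∈ (C.zip C.tail).toFinset) v₀ q := by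
        intro q hq
        obtain ⟨j, hj, rfl⟩ := List.getElem_of_mem hq
        exact reflTransGen_head_getElem hCchain' hCne hj
      intro x hx y hy
      have hxC : x ∈ C := List.mem_cons_of_mem _ (List.mem_toFinset.1 hx)
      have hyC : y ∈ C := List.mem_cons_of_mem _ (List.mem_toFinset.1 hy)
      exact (hto x hxC).trans (hfrom y hyC)
    · -- `|E₀| ≤ |C.zip C.tail| = |b :: l| = |W₀|`, and `|W₀| ≥ 3`
      have h1 : (C.zip C.tail).toFinset.card ≤ (b :: l).length := by
        refine (List.toFinset_card_le _).trans ?_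
        simp [hC]
      rw [List.toFinset_card_of_nodup hnd] at hW0card ⊢
      omega
  intro μ
  induction μ using Nat.strong_induction_on with
  | _ μ ih =>
  intro W E hμ hEA hEW hWne hstrong hbound
  by_cases hWuniv : W = Finset.univ
  · -- every arc lies inside `W`, hence in `E`
    have hAE : A ⊆ E := fun e he =>
      hinside W E hEA hstrong e he (hWuniv ▸ Finset.mem_univ _) (hWuniv ▸ Finset.mem_univ _)
    have h1 := Finset.card_le_card hAE
    rw [hWuniv, Finset.card_univ, Fintype.card_fin] at hbound
    omega
  · -- add an ear
    obtain ⟨t, ht⟩ : ∃ t, t ∉ W := by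
      by_contra h
      exact hWuniv (Finset.eq_univ_iff_forall.2 fun t => not_not.1 fun ht => h ⟨t, ht⟩)
    obtain ⟨w, hw⟩ := hWne
    obtain ⟨l₁, hc₁, -, hlast₁⟩ := hs.exists_path w t
    obtain ⟨i, hi, hxW, hyW⟩ := exists_succ_mem_not_mem (W : Set (Fin m)) (w :: l₁)
      (List.cons_ne_nil _ _) (by simpa using hw) (by rw [hlast₁]; simpa using ht)
    set x := (w :: l₁)[i] with hxdef
    set y := (w :: l₁)[i + 1] with hydef
    have hxy : IsArc K x y := List.isChain_iff_getElem.1 hc₁ i hi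
    obtain ⟨l₂, hc₂, hnd₂, hlast₂⟩ := hs.exists_path y w
    obtain ⟨k, hk, hkW, hfirst⟩ := exists_first_mem (W : Set (Fin m)) (y :: l₂)
      (List.cons_ne_nil _ _) (by rw [hlast₂]; simpa using hw)
    have hk0 : k ≠ 0 := by
      rintro rfl
      exact hyW (by simpa using hkW)
    set Q := (y :: l₂).take (k + 1) with hQdef
    have hQne : Q ≠ [] := by simp [hQdef]
    have hQlen : Q.length = k + 1 := by
      rw [hQdef, List.length_take]
      exact Nat.min_eq_left hk
    have hQget : ∀ (j : ℕ) (hj : j < Q.length), Q[j] = (y :: l₂)[j]'(by rw [hQlen] at hj; omega) :=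
      fun j hj => by simp only [hQdef, List.getElem_take]
    have hQchain : Q.IsChain (IsArc K) := hc₂.take (k + 1)
    have hQnd : Q.Nodup := hnd₂.sublist (List.take_sublist _ _)
    have hQhead : Q.head hQne = y := by rw [List.head_eq_getElem, hQget]; rfl
    have hQlastW : Q.getLast hQne ∈ W := by
      rw [List.getLast_eq_getElem, hQget]
      simpa [hQlen] using hkW
    have hQint : ∀ (j : ℕ) (hj : j < k), Q[j]'(by rw [hQlen]; omega) ∉ W := by
      intro j hj hW
      rw [hQget] at hW
      exact hfirst j hj (by simpa using hW)
    -- the new sub-digraph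
    set W' : Finset (Fin m) := W ∪ Q.toFinset with hW'
    set E' : Finset (Fin m × Fin m) := insert (x, y) (E ∪ (Q.zip Q.tail).toFinset) with hE'
    have hEE' : E ⊆ E' := fun f hf => Finset.mem_insert_of_mem (Finset.mem_union_left _ hf)
    have hQarcs : ∀ p ∈ Q.zip Q.tail, IsArc K p.1 p.2 := fun p hp => rel_of_mem_zip_tail hQchain hp
    have hE'A : E' ⊆ A := by
      intro f hf
      rcases Finset.mem_insert.1 hf with rfl | hf
      · exact (hA _).2 hxy
      · rcases Finset.mem_union.1 hf with hf | hf
        · exact hEA hf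
        · exact (hA f).2 (hQarcs f (List.mem_toFinset.1 hf))
    have hyQ : y ∈ Q := by rw [← hQhead]; exact List.head_mem hQne
    have hxW' : x ∈ W := by simpa [hxdef] using hxW
    have hE'W : ∀ f ∈ E', f.1 ∈ W' ∧ f.2 ∈ W' := by
      intro f hf
      rcases Finset.mem_insert.1 hf with rfl | hf
      · exact ⟨Finset.mem_union_left _ hxW', Finset.mem_union_right _ (List.mem_toFinset.2 hyQ)⟩
      · rcases Finset.mem_union.1 hf with hf | hf
        · exact ⟨Finset.mem_union_left _ (hEW f hf).1, Finset.mem_union_left _ (hEW f hf).2⟩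
        · have h12 := List.of_mem_zip (List.mem_toFinset.1 hf)
          exact ⟨Finset.mem_union_right _ (List.mem_toFinset.2 h12.1),
            Finset.mem_union_right _ (List.mem_toFinset.2 (List.mem_of_mem_tail h12.2))⟩
    -- reachability in the new sub-digraph
    have hρ_mono : ∀ a b, Relation.ReflTransGen (fun a b => (a, b) ∈ E) a b →
        Relation.ReflTransGen (fun a b => (a, b) ∈ E') a b := fun a b h =>
      reflTransGen_of_imp (fun a b hab => hEE' hab) h
    have hQchain' : Q.IsChain (fun a b => (a, b) ∈ E') := by
      rw [List.isChain_iff_getElem]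
      intro j hj
      apply Finset.mem_insert_of_mem
      apply Finset.mem_union_right
      rw [List.mem_toFinset, List.mem_iff_getElem]
      refine ⟨j, by simp; omega, ?_⟩
      rw [List.getElem_zip]; simp
    have hy_to : ∀ q ∈ Q, Relation.ReflTransGen (fun a b => (a, b) ∈ E') y q := by
      intro q hq
      obtain ⟨j, hj, rfl⟩ := List.getElem_of_mem hq
      rw [← hQhead]
      exact reflTransGen_head_getElem hQchain' hQne hj
    have hto_last : ∀ q ∈ Q, Relation.ReflTransGen (fun a b => (a, b) ∈ E') q (Q.getLast hQne) := by
      intro q hq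
      obtain ⟨j, hj, rfl⟩ := List.getElem_of_mem hq
      exact reflTransGen_getElem_getLast hQchain' hQne hj
    have hxy' : Relation.ReflTransGen (fun a b => (a, b) ∈ E') x y :=
      Relation.ReflTransGen.single (Finset.mem_insert_self _ _)
    have hstrong' : ∀ a ∈ W', ∀ b ∈ W', Relation.ReflTransGen (fun a b => (a, b) ∈ E') a b := by
      intro a ha b hb
      rcases Finset.mem_union.1 ha with ha | ha <;> rcases Finset.mem_union.1 hb with hb | hb
      · exact hρ_mono a b (hstrong a ha b hb)
      · exact (hρ_mono a x (hstrong a ha x hxW')).trans (hxy'.trans (hy_to b (List.mem_toFinset.1 hb)))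
      · exact (hto_last a (List.mem_toFinset.1 ha)).trans (hρ_mono _ b (hstrong _ hQlastW b hb))
      · exact (hto_last a (List.mem_toFinset.1 ha)).trans
          ((hρ_mono _ x (hstrong _ hQlastW x hxW')).trans (hxy'.trans (hy_to b (List.mem_toFinset.1 hb))))
    -- counting: `k` new vertices, at most `k + 1` new arcs
    have hnew : (Q.take k).toFinset ⊆ W' ∧ Disjoint W (Q.take k).toFinset ∧
        (Q.take k).toFinset.card = k := by
      refine ⟨fun q hq => Finset.mem_union_right _ (List.mem_toFinset.2
        (List.take_sublist _ _ |>.subset (List.mem_toFinset.1 hq))), ?_, ?_⟩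
      · rw [Finset.disjoint_right]
        intro q hq
        obtain ⟨j, hj, rfl⟩ := List.getElem_of_mem (List.mem_toFinset.1 hq)
        simp only [List.length_take] at hj
        simp only [List.getElem_take]
        exact hQint j (by omega)
      · rw [List.toFinset_card_of_nodup (hQnd.sublist (List.take_sublist _ _)), List.length_take,
          hQlen]
        omega
    obtain ⟨hsubW', hdisj, hcardk⟩ := hnew
    have hW'card : W.card + k ≤ W'.card := by
      rw [← hcardk, ← Finset.card_union_of_disjoint hdisj]
      exact Finset.card_le_card (Finset.union_subset Finset.subset_union_left hsubW')
    have hE'card : E'.card ≤ E.card + (k + 1) := by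
      have h1 : E'.card ≤ (E ∪ (Q.zip Q.tail).toFinset).card + 1 := Finset.card_insert_le _ _
      have h2 : (E ∪ (Q.zip Q.tail).toFinset).card ≤ E.card + (Q.zip Q.tail).toFinset.card :=
        Finset.card_union_le _ _
      have h3 : (Q.zip Q.tail).toFinset.card ≤ k := by
        refine (List.toFinset_card_le _).trans ?_
        simp [hQlen]
      omega
    have hbound' : E'.card + 3 ≤ 2 * W'.card := by omega
    -- the measure decreases
    have hlt : m - W'.card < μ := by
      have h4 : W'.card ≤ m := by simpa using Finset.card_le_univ W'
      omega
    exact ih _ (hμ ▸ hlt) W' E' rfl hE'A hE'W ⟨w, Finset.mem_union_left _ hw⟩ hstrong' hbound'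

end Literature.Combinatorics.SimpleGraph
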